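import Literature.NumberTheory.EllipticCurves.EtaQuotientQExpansionProofs
import Mathlib.NumberTheory.Padics.RingHoms
import HarnessLib

/-!
# `η`-unit series that are `2`-adic squares have even exponents at the ODD scales (half of E-an-49⁺)

Summit `BirchSwinnertonDyer`, route `ManinLocalTwoThree` (cell bsd-f2-manin), crux C2 `ManinOddAtFour` (stmt-BirchSwinnertonDyer-22967),
line `kato_shift_two` v6/v7, stub `stub_minimalReducibleResidual` (the `W[2]`-REDUCIBLE residual Rb); an g14's cuspidal-Kummer
certificate MEMO-an §56, support theorem **E-an-49⁺ `EtaUnitSquareIffEven`** (HOME/an/Sketch-an-g14.lean): «for `0 ∉ S`, the unit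
series `g ∈ 1 + qℤ⟦q⟧` of `∏_δ E(q^δ)^{r_δ}` (`E(q^δ) = ∏(1 − q^{δn}) = formalEulerScaled δ`) is a square in `ℤ₂⟦q⟧` iff all `r_δ`
are even».  This file proves the ODD-SCALE half of `⇒` (MEMO-an §56.3, first case of the proof):

* **`even_of_isSquare_etaUnit_of_odd`** — if `g` is a `2`-adic square then `r_δ` is even for every ODD `δ ∈ S`.

Route (no truncation rings, no pentagonal theorem — only `E(q^δ) = 1 − q^δ + O(q^{2δ})` through the tree's
`coeff_formalEulerScaled`): reduce mod `2`; squares in `𝔽₂⟦q⟧` have no odd-degree terms (`coeff_odd_eq_zero_of_isSquare`); if `δ₀`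
is the least odd `δ` with `r_δ` odd, the functional `c = coeff δ₀` is ADDITIVE on products of series whose odd coefficients below
`δ₀` vanish (`coeff_mul_of_oddVanish`), every factor `E(q^δ)^{|r_δ|}` of the defining identity `g·∏_{r<0} = ∏_{r>0}` is such a
series, and `c` of the two sides differ by `|r_{δ₀}|·c(E(q^{δ₀})) = 1` — contradiction.  (The even-scale descent `F(q²) □ ⇔ F □`
is the other half, to follow.)  The hypothesis is `IsEtaUnitSeries S r g` unfolded (an's def is a sketch, not in the tree).

No new definitions; nothing about BSD or Manin's conjecture is proved here.

References: cell memo HOME/MEMO-an.md §56.3; T. M. Apostol, *Modular functions and Dirichlet series in number theory*, GTM 41,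
§3.1–§3.2 [cite: Apostol1990, §3.1–§3.2]; G. Köhler, *Eta products and theta series identities* (2011) §2.1.
-/

set_option autoImplicit false
set_option linter.dupNamespace false

open PowerSeries Literature.NumberTheory.EllipticCurves.ModularForms

namespace Summit.BirchSwinnertonDyer.BirchSwinnertonDyer.Theorems.ManinLocalTwoThree

noncomputable section

/-! ### §1  Squares in `𝔽₂⟦q⟧` have no odd-degree terms -/

section CharTwo

/-- In `(ZMod 2)⟦X⟧` a square has vanishing odd-degree coefficients (`(Σ aᵢqⁱ)² = Σ aᵢ²q²ⁱ`). [folklore] -/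
theorem coeff_odd_eq_zero_of_isSquare {f : PowerSeries (ZMod 2)} (hf : IsSquare f) {n : ℕ} (hn : Odd n) :
    coeff n f = 0 := by
  obtain ⟨h, rfl⟩ := hf
  rw [coeff_mul]
  -- the swap involution on the antidiagonal has no fixed point (`n` odd) and pairs equal terms
  refine Finset.sum_involution (fun p _ => p.swap) ?_ ?_ ?_ ?_
  · intro p hp
    rw [Prod.fst_swap, Prod.snd_swap, mul_comm (coeff p.2 h), ← two_mul]
    have : (2 : ZMod 2) = 0 := rfl
    rw [this, zero_mul]
  · intro p hp _ hps
    rw [Finset.mem_antidiagonal] at hp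
    have h1 : p.1 = p.2 := by
      have := congrArg Prod.fst hps
      simpa using this.symm
    exfalso
    rw [← hp, ← h1, ← two_mul] at hn
    exact (Nat.not_even_iff_odd.mpr hn) (even_two_mul _)
  · intro p hp
    simpa [Finset.mem_antidiagonal, add_comm] using hp
  · intro p _
    exact Prod.swap_swap p

/-- **Additivity of the `δ₀`-th coefficient** on products of series with constant term `1` whose odd coefficients below the
odd index `δ₀` vanish; the product is again such a series. [folklore] -/
theorem coeff_mul_of_oddVanish {δ₀ : ℕ} (hδ₀ : Odd δ₀) {f g : PowerSeries (ZMod 2)}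
    (hf0 : constantCoeff f = 1) (hg0 : constantCoeff g = 1)
    (hf : ∀ i, Odd i → i < δ₀ → coeff i f = 0) (hg : ∀ i, Odd i → i < δ₀ → coeff i g = 0) :
    constantCoeff (f * g) = 1 ∧ (∀ i, Odd i → i < δ₀ → coeff i (f * g) = 0) ∧
      coeff δ₀ (f * g) = coeff δ₀ f + coeff δ₀ g := by
  refine ⟨by rw [map_mul, hf0, hg0, mul_one], ?_, ?_⟩
  · intro i hi hiδ
    rw [coeff_mul]
    refine Finset.sum_eq_zero fun p hp => ?_
    rw [Finset.mem_antidiagonal] at hp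
    -- one of `p.1`, `p.2` is odd and `< δ₀`
    rcases Nat.even_or_odd p.1 with h1 | h1
    · have h2 : Odd p.2 := by
        rcases Nat.even_or_odd p.2 with h2 | h2
        · exfalso; rw [← hp] at hi; exact (Nat.not_even_iff_odd.mpr hi) (h1.add h2)
        · exact h2
      rw [hg p.2 h2 (by omega), mul_zero]
    · rw [hf p.1 h1 (by omega), zero_mul]
  · rw [coeff_mul]
    -- only `(δ₀, 0)` and `(0, δ₀)` contribute
    have hδ0 : 0 < δ₀ := hδ₀.pos
    rw [Finset.sum_eq_add_of_mem (⟨δ₀, 0⟩ : ℕ × ℕ) (⟨0, δ₀⟩ : ℕ × ℕ) (by simp) (by simp)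
      (by intro h; have := congrArg Prod.fst h; simp at this; omega)]
    · simp only [coeff_zero_eq_constantCoeff, hf0, hg0, mul_one, one_mul]
    · intro p hp hpne
      obtain ⟨hp1, hp2⟩ := hpne
      rw [Finset.mem_antidiagonal] at hp
      rcases Nat.even_or_odd p.1 with h1 | h1
      · -- `p.2` odd; `p.2 < δ₀` unless `p = (0, δ₀)`
        have h2 : Odd p.2 := by
          rcases Nat.even_or_odd p.2 with h2 | h2
          · rw [← hp] at hδ₀; exact absurd (Even.add h1 h2) (Nat.not_even_iff_odd.mpr hδ₀)
          · exact h2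
        have hlt : p.2 < δ₀ := by
          rcases Nat.lt_or_ge p.2 δ₀ with h | h
          · exact h
          · exfalso; apply hp2
            have h2' : p.2 = δ₀ := by omega
            have h1' : p.1 = 0 := by omega
            exact Prod.ext h1' h2'
        rw [hg p.2 h2 hlt, mul_zero]
      · have hlt : p.1 < δ₀ := by
          rcases Nat.lt_or_ge p.1 δ₀ with h | h
          · exact h
          · exfalso; apply hp1
            have h1' : p.1 = δ₀ := by omega
            have h2' : p.2 = 0 := by omega
            exact Prod.ext h1' h2'
        rw [hf p.1 h1 hlt, zero_mul]

/-- Powers: `f^n` keeps the vanishing and `coeff δ₀ (f^n) = n • coeff δ₀ f`. [folklore] -/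
theorem coeff_pow_of_oddVanish {δ₀ : ℕ} (hδ₀ : Odd δ₀) {f : PowerSeries (ZMod 2)}
    (hf0 : constantCoeff f = 1) (hf : ∀ i, Odd i → i < δ₀ → coeff i f = 0) (n : ℕ) :
    constantCoeff (f ^ n) = 1 ∧ (∀ i, Odd i → i < δ₀ → coeff i (f ^ n) = 0) ∧ coeff δ₀ (f ^ n) = n • coeff δ₀ f := by
  induction n with
  | zero =>
    refine ⟨by simp, ?_, ?_⟩
    · intro i hi _
      rw [pow_zero, coeff_one, if_neg]; exact Nat.pos_iff_ne_zero.mp hi.pos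
    · rw [pow_zero, coeff_one, if_neg (Nat.pos_iff_ne_zero.mp hδ₀.pos), zero_smul]
  | succ n ih =>
    obtain ⟨h0, hA, hc⟩ := ih
    obtain ⟨h0', hA', hc'⟩ := coeff_mul_of_oddVanish hδ₀ h0 hf0 hA hf
    refine ⟨by rw [pow_succ]; exact h0', by rw [pow_succ]; exact hA', ?_⟩
    rw [pow_succ, hc', hc, succ_nsmul]

/-- Finite products: the vanishing is kept and `coeff δ₀` is additive. [folklore] -/
theorem coeff_prod_of_oddVanish {δ₀ : ℕ} (hδ₀ : Odd δ₀) {ι : Type*} (s : Finset ι) (F : ι → PowerSeries (ZMod 2))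
    (hF0 : ∀ i ∈ s, constantCoeff (F i) = 1) (hF : ∀ i ∈ s, ∀ j, Odd j → j < δ₀ → coeff j (F i) = 0) :
    constantCoeff (∏ i ∈ s, F i) = 1 ∧ (∀ j, Odd j → j < δ₀ → coeff j (∏ i ∈ s, F i) = 0) ∧
      coeff δ₀ (∏ i ∈ s, F i) = ∑ i ∈ s, coeff δ₀ (F i) := by
  classical
  induction s using Finset.induction_on with
  | empty =>
    refine ⟨by simp, ?_, ?_⟩
    · intro j hj _; rw [Finset.prod_empty, coeff_one, if_neg]; exact Nat.pos_iff_ne_zero.mp hj.pos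
    · rw [Finset.prod_empty, Finset.sum_empty, coeff_one, if_neg (Nat.pos_iff_ne_zero.mp hδ₀.pos)]
  | insert a s ha ih =>
    obtain ⟨h0, hA, hc⟩ := ih (fun i hi => hF0 i (Finset.mem_insert_of_mem hi))
      (fun i hi => hF i (Finset.mem_insert_of_mem hi))
    obtain ⟨h0', hA', hc'⟩ := coeff_mul_of_oddVanish hδ₀ (hF0 a (Finset.mem_insert_self a s)) h0
      (hF a (Finset.mem_insert_self a s)) hA
    rw [Finset.prod_insert ha, Finset.sum_insert ha]
    exact ⟨h0', hA', by rw [hc', hc]⟩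

end CharTwo

/-! ### §2  The Euler factors `E(q^δ)` modulo `2` -/

section Euler

/-- `coeff 1 (∏ (1 - Xⁿ)) = -1`. [folklore] -/
theorem coeff_one_formalEulerPow_one : coeff 1 (formalEulerPow 1) = -1 := by
  rw [coeff_formalEulerPow (le_refl 1), eulerTrunc, Finset.prod_range_one, pow_one, zero_add, pow_one, map_sub, coeff_one,
    if_neg one_ne_zero, coeff_one_X, zero_sub]

/-- `E(q^δ) mod 2`: constant term `1`. [folklore] -/
theorem constantCoeff_formalEulerScaled_map (δ : ℕ) :
    constantCoeff ((formalEulerScaled δ).map (Int.castRingHom (ZMod 2))) = 1 := by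
  rw [← coeff_zero_eq_constantCoeff_apply, coeff_map, coeff_zero_eq_constantCoeff_apply, constantCoeff_formalEulerScaled,
    map_one]

/-- `E(q^δ) mod 2` has no terms in degrees not divisible by `δ`. [folklore] -/
theorem coeff_formalEulerScaled_map_of_not_dvd {δ i : ℕ} (h : ¬ δ ∣ i) :
    coeff i ((formalEulerScaled δ).map (Int.castRingHom (ZMod 2))) = 0 := by
  rw [coeff_map, coeff_formalEulerScaled, if_neg h, map_zero]

/-- `E(q^δ) mod 2` has coefficient `1` in degree `δ ≥ 1`. [folklore] -/
theorem coeff_self_formalEulerScaled_map {δ : ℕ} (hδ : 0 < δ) :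
    coeff δ ((formalEulerScaled δ).map (Int.castRingHom (ZMod 2))) = 1 := by
  rw [coeff_map, coeff_formalEulerScaled, if_pos dvd_rfl, Nat.div_self hδ, coeff_one_formalEulerPow_one]
  rfl

end Euler

/-! ### §3  Odd scales: a `2`-adic square has even exponents at every odd `δ` -/

section OddScales

/-- **E-an-49⁺, odd-scale half**: let `0 ∉ S` and let `g ∈ 1 + qℤ⟦q⟧` satisfy the `η`-unit-series identity
`g · ∏_δ E(q^δ)^{(−r_δ)⁺} = ∏_δ E(q^δ)^{(r_δ)⁺}` (an's `IsEtaUnitSeries S r g`, unfolded).  If `g` is a square in `ℤ₂⟦q⟧` then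
`r_δ` is even for every odd `δ ∈ S`. [cite: Apostol1990, §3.1–§3.2 (η(τ) = e^{πiτ/12}∏(1 − e^{2πinτ}); integrality of the product expansion)] -/
theorem even_of_isSquare_etaUnit_of_odd (S : Finset ℕ) (r : ℕ → ℤ) (g : PowerSeries ℤ) (hS : 0 ∉ S)
    (hg : constantCoeff g = 1 ∧
      g * ∏ δ ∈ S, formalEulerScaled δ ^ (-(r δ)).toNat = ∏ δ ∈ S, formalEulerScaled δ ^ (r δ).toNat)
    (hsq : IsSquare (g.map (Int.castRingHom ℤ_[2]))) :
    ∀ δ ∈ S, Odd δ → Even (r δ) := by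
  classical
  by_contra hex
  push Not at hex
  -- the least odd `δ` with `r_δ` odd
  let T : Finset ℕ := S.filter fun δ => Odd δ ∧ Odd (r δ)
  have hTne : T.Nonempty := by
    obtain ⟨δ, hδS, hδ, hr⟩ := hex
    exact ⟨δ, Finset.mem_filter.mpr ⟨hδS, hδ, Int.not_even_iff_odd.mp hr⟩⟩
  set δ₀ := T.min' hTne with hδ₀def
  have hδ₀T : δ₀ ∈ T := Finset.min'_mem T hTne
  obtain ⟨hδ₀S, hδ₀odd, hr₀odd⟩ := Finset.mem_filter.mp hδ₀T
  have hmin : ∀ δ ∈ S, Odd δ → Odd (r δ) → δ₀ ≤ δ :=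
    fun δ hδ h1 h2 => Finset.min'_le T δ (Finset.mem_filter.mpr ⟨hδ, h1, h2⟩)
  -- reduce modulo `2`
  let π : ℤ →+* ZMod 2 := Int.castRingHom (ZMod 2)
  let e : ℕ → PowerSeries (ZMod 2) := fun δ => (formalEulerScaled δ).map π
  let gb : PowerSeries (ZMod 2) := g.map π
  have hgb_sq : IsSquare gb := by
    obtain ⟨h, hh⟩ := hsq
    refine ⟨h.map (PadicInt.toZMod (p := 2)), ?_⟩
    have e1 : gb = (g.map (Int.castRingHom ℤ_[2])).map (PadicInt.toZMod (p := 2)) := by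
      have hc : ((PadicInt.toZMod (p := 2)).comp (Int.castRingHom ℤ_[2])) = π := RingHom.ext_int _ _
      have := congrArg (fun φ : ℤ →+* ZMod 2 => PowerSeries.map φ g) hc
      change PowerSeries.map ((PadicInt.toZMod (p := 2)).comp (Int.castRingHom ℤ_[2])) g = PowerSeries.map π g at this
      show PowerSeries.map π g = _
      rw [← this, PowerSeries.map_comp]
      rfl
    rw [e1, hh, map_mul]
  have hid : gb * ∏ δ ∈ S, e δ ^ (-(r δ)).toNat = ∏ δ ∈ S, e δ ^ (r δ).toNat := by
    have := congrArg (PowerSeries.map π) hg.2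
    simpa only [map_mul, map_prod, map_pow] using this
  have hgb0 : constantCoeff gb = 1 := by
    show constantCoeff (g.map π) = 1
    rw [← coeff_zero_eq_constantCoeff_apply, coeff_map, coeff_zero_eq_constantCoeff_apply, hg.1, map_one]
  -- the functional `c = coeff δ₀` and the vanishing predicate, factor by factor
  have hfac : ∀ δ ∈ S, ∀ n : ℕ, (Odd (r δ) ∨ Even n) →
      constantCoeff (e δ ^ n) = 1 ∧ (∀ i, Odd i → i < δ₀ → coeff i (e δ ^ n) = 0) ∧
        coeff δ₀ (e δ ^ n) = if δ = δ₀ then (n : ZMod 2) else 0 := by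
    intro δ hδS n hn
    have hδ0 : 0 < δ := Nat.pos_of_ne_zero (fun h => hS (h ▸ hδS))
    by_cases hA : ∀ i, Odd i → i < δ₀ → coeff i (e δ) = 0
    · -- `e δ` itself is admissible: `δ` even, or `δ` odd with `δ ≥ δ₀`
      obtain ⟨h0, hA', hc⟩ := coeff_pow_of_oddVanish hδ₀odd (constantCoeff_formalEulerScaled_map δ) hA n
      refine ⟨h0, hA', ?_⟩
      rw [hc]
      by_cases hδδ : δ = δ₀
      · subst hδδ
        rw [if_pos rfl, coeff_self_formalEulerScaled_map hδ0, nsmul_eq_mul, mul_one]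
      · rw [if_neg hδδ]
        have hnd : ¬ δ ∣ δ₀ := by
          intro hd
          rcases Nat.even_or_odd δ with hev | hodd
          · exact (Nat.not_even_iff_odd.mpr hδ₀odd) ((even_iff_two_dvd.mp hev).trans hd |> even_iff_two_dvd.mpr)
          · -- `δ` odd, `δ ∣ δ₀`, `δ ≠ δ₀`: then `δ < δ₀`, and `e δ` would have the odd coefficient `coeff δ = 1 ≠ 0`
            have hlt : δ < δ₀ := lt_of_le_of_ne (Nat.le_of_dvd hδ₀odd.pos hd) hδδ
            have := hA δ hodd hlt
            rw [coeff_self_formalEulerScaled_map hδ0] at this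
            exact one_ne_zero this
        rw [coeff_formalEulerScaled_map_of_not_dvd hnd, smul_zero]
    · -- `e δ` is NOT admissible: then `δ` is odd and `< δ₀`, so `r δ` is even, so `n` is even and `e δ ^ n` is a square
      have hδodd : Odd δ := by
        rcases Nat.even_or_odd δ with hev | hodd
        · exfalso; apply hA; intro i hi _
          exact coeff_formalEulerScaled_map_of_not_dvd fun hd =>
            (Nat.not_even_iff_odd.mpr hi) (even_iff_two_dvd.mpr ((even_iff_two_dvd.mp hev).trans hd))
        · exact hodd
      have hlt : δ < δ₀ := by
        by_contra hle
        apply hA; intro i hi hiδ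
        exact coeff_formalEulerScaled_map_of_not_dvd fun hd => by
          have := Nat.le_of_dvd hi.pos hd; omega
      have hreven : Even (r δ) := by
        by_contra hro
        exact absurd (hmin δ hδS hδodd (Int.not_even_iff_odd.mp hro)) (not_le.mpr hlt)
      have hneven : Even n := hn.resolve_left (Int.not_odd_iff_even.mpr hreven)
      obtain ⟨k, rfl⟩ := hneven
      have hsq : IsSquare (e δ ^ (k + k)) := ⟨e δ ^ k, by rw [pow_add]⟩
      refine ⟨?_, fun i hi _ => coeff_odd_eq_zero_of_isSquare hsq hi, ?_⟩
      · rw [map_pow, constantCoeff_formalEulerScaled_map, one_pow]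
      · rw [coeff_odd_eq_zero_of_isSquare hsq hδ₀odd]
        have hne : δ ≠ δ₀ := fun h => (Int.not_odd_iff_even.mpr hreven) (h ▸ hr₀odd)
        rw [if_neg hne]
  -- parities of the exponents `(± r δ)⁺`
  have even_toNat : ∀ {z : ℤ}, Even z → Even z.toNat := by
    intro z hz
    rcases le_or_gt 0 z with h0 | h0
    · obtain ⟨k, hk⟩ := hz
      have hk0 : 0 ≤ k := by omega
      refine ⟨k.toNat, ?_⟩
      have : (z.toNat : ℤ) = k.toNat + k.toNat := by rw [Int.toNat_of_nonneg h0, Int.toNat_of_nonneg hk0]; exact hk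
      exact_mod_cast this
    · rw [Int.toNat_eq_zero.mpr h0.le]; exact Even.zero
  have hparR : ∀ δ, Odd (r δ) ∨ Even (r δ).toNat := fun δ => by
    rcases Int.even_or_odd (r δ) with h | h
    · exact Or.inr (even_toNat h)
    · exact Or.inl h
  have hparL : ∀ δ, Odd (r δ) ∨ Even (-(r δ)).toNat := fun δ => by
    rcases Int.even_or_odd (r δ) with h | h
    · exact Or.inr (even_toNat h.neg)
    · exact Or.inl h
  -- apply the functional to both sides of the identity
  obtain ⟨hL0, hLA, hLc⟩ := coeff_prod_of_oddVanish hδ₀odd S (fun δ => e δ ^ (-(r δ)).toNat)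
    (fun δ hδ => (hfac δ hδ _ (hparL δ)).1) (fun δ hδ => (hfac δ hδ _ (hparL δ)).2.1)
  obtain ⟨-, -, hRc⟩ := coeff_prod_of_oddVanish hδ₀odd S (fun δ => e δ ^ (r δ).toNat)
    (fun δ hδ => (hfac δ hδ _ (hparR δ)).1) (fun δ hδ => (hfac δ hδ _ (hparR δ)).2.1)
  have hgbA : ∀ i, Odd i → i < δ₀ → coeff i gb = 0 := fun i hi _ => coeff_odd_eq_zero_of_isSquare hgb_sq hi
  have hgbc : coeff δ₀ gb = 0 := coeff_odd_eq_zero_of_isSquare hgb_sq hδ₀odd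
  obtain ⟨-, -, hc⟩ := coeff_mul_of_oddVanish hδ₀odd hgb0 hL0 hgbA hLA
  rw [hid, hRc, hgbc, zero_add, hLc, Finset.sum_congr rfl (fun δ hδ => (hfac δ hδ _ (hparR δ)).2.2),
    Finset.sum_congr rfl (fun δ hδ => (hfac δ hδ _ (hparL δ)).2.2), Finset.sum_ite_eq', Finset.sum_ite_eq',
    if_pos hδ₀S, if_pos hδ₀S] at hc
  -- `hc : ((r δ₀)⁺ : 𝔽₂) = ((−r δ₀)⁺ : 𝔽₂)`, but `(r δ₀)⁺ + (−r δ₀)⁺ = |r δ₀|` is odd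
  have hodd : Odd ((r δ₀).toNat + (-(r δ₀)).toNat) := by
    rw [Int.toNat_add_toNat_neg_eq_natAbs]; exact Int.natAbs_odd.mpr hr₀odd
  have hzero : (((r δ₀).toNat + (-(r δ₀)).toNat : ℕ) : ZMod 2) = 0 := by
    push_cast
    rw [hc]
    exact CharTwo.add_self_eq_zero _
  exact (Nat.not_even_iff_odd.mpr hodd) (ZMod.natCast_eq_zero_iff_even.mp hzero)

end OddScales

end

end Summit.BirchSwinnertonDyer.BirchSwinnertonDyer.Theorems.ManinLocalTwoThree
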